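import Mathlib
import Summits.Ventures.HodgeRepro.Tier4.Common.AdelicDefs
import Summits.Ventures.HodgeRepro.Tier4.Common.CompactOpenLevel
import Summits.Ventures.HodgeRepro.Tier4.Line1.FiniteLevelIsolation
import Summits.Ventures.HodgeRepro.Tier4.Line1.RationalPoints
import Summits.Ventures.HodgeRepro.Tier4.Line4.TorusProduct
import Summits.Ventures.HodgeRepro.Tier4.Line4.TransporterLocal

/-!
# Tier4/Line4/TorusArchClosed — the archimedean torus `T_∞` meets the rational torus `T(k)` trivially and
`T(k) · T_∞` is closed in `T(𝔸)` (C-L4-B-ARCH-CLOSED; the two consumer-side obligations of the half-(B) reading)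

Blind re-derivation cell `pub-hodge-repro`, Tier 4 «prove the step» (README §9–§10), seat t4-L4-p2 (prover, LINE L4,
gen 6; cut C-L4-B-ARCH-CLOSED, bus S16548 / plan-4 S16550).  Tree path
`lean/Summits/Ventures/HodgeRepro/Tier4/Line4/TorusArchClosed.lean`.  Mathlib + the tree only; no print; no
definition; no instance.

WHY.  The wall's half (B) asks characters of `T(𝔸)` trivial on `T(k)` with PRESCRIBED archimedean components.  With
`T(k)\T(𝔸)` compact (TorusCocompactAniso p718934, anisotropic genuine planes), the existence half is the
character-extension theorem for compact abelian groups (Deitmar–Echterhoff 2014 Cor 3.6.2, lit-5 row I-t4-lit-5-69)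
applied to the CLOSED subgroup `T(k)·T_∞ / T(k) ≅ T_∞` of `T(k)\T(𝔸)` — provided (i) `T(k) ∩ T_∞ = 1` (so the image
of `T_∞` is a copy of `T_∞`) and (ii) `T(k) · T_∞` is closed in `T(𝔸)`.  Both are Mathlib-level and are proved here:
* `eq_one_of_mem_rationalPoints_of_mem_infinitePart` — a rational element of `U(W)(𝔸)` with finite part `1` is `1`
  (its matrix is `adMat A`, `A` rational; the finite part reads `A` at any finite place, `k → k_v` is injective);
* `rationalOf_inf_torusInf_eq_bot` — `T(k) ∩ T_∞ = ⊥` in `T(𝔸)`;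
* `isClosed_rationalOf_mul_torusInf` — under `[CompactSpace (torusInf W)]` (typer-2's TorusInfCompact at the line's
  planes, `compactSpace_torusInf_seesaw_skel` in the skeleton), `T(k) · T_∞` is closed: a closed subgroup times a
  compact subgroup (Mathlib `IsClosed.mul_right_of_isCompact`; `rationalPoints_closed` L1-p5).
The identity of the face's character (which weights, which finite data) is the bridge's; nothing here chooses it.
Nothing here says anything about the status of the Hodge conjecture for CM abelian varieties, which is NOT proved;
HC_CM is NOT proved by anyone in this repository.
-/

set_option autoImplicit false

noncomputable section

namespace Summit.Ventures.HodgeRepro.Tier4.Line4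

open Matrix NumberField IsDedekindDomain Summit.Ventures.HodgeRepro.Tier4.Common
  Summit.Ventures.HodgeRepro.Tier4.Line1 Topology
open scoped Pointwise NumberField

variable {k : Type} [Field k] [NumberField k] (W : PlaneData k)

/-- **a rational element with finite part `1` is `1`**: its matrix is `adMat A` with `A` rational, and the finite
part of `adMat A` at any finite place `v` is `A` read in `k_v`; `k → k_v` is injective, so `A = 1`. -/
theorem eq_one_of_mem_rationalPoints_of_mem_infinitePart {g : GA W} (hr : g ∈ rationalPoints W)
    (hi : g ∈ infinitePart W) : g = 1 := by
  rw [rationalPoints, Subgroup.mem_subgroupOf, principalGL, MonoidHom.mem_range] at hr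
  obtain ⟨A, hA⟩ := hr
  have hmat : GA.mat W g = adMat k (A : Matrix (Fin 4) (Fin 4) k) := by
    have h1 : ((Matrix.GeneralLinearGroup.map (algebraMap k (Ad k)) A : GL4 k) : M4 k) = ((g : GL4 k) : M4 k) :=
      congrArg Units.val hA
    show ((g : GL4 k) : M4 k) = adMat k (A : Matrix (Fin 4) (Fin 4) k)
    rw [← h1]
    show (RingHom.mapMatrix (algebraMap k (Ad k))) (A : Matrix (Fin 4) (Fin 4) k) = adMat k (A : Matrix (Fin 4) (Fin 4) k)
    rw [RingHom.mapMatrix_apply]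
    rfl
  rw [mem_infinitePart, hmat] at hi
  obtain ⟨v, -⟩ := exists_heightOneSpectrum_natCast_mem k 2 Nat.prime_two
  have hinj : Function.Injective (algebraMap k (v.adicCompletion k)) := (algebraMap k (v.adicCompletion k)).injective
  have hA1 : (A : Matrix (Fin 4) (Fin 4) k) = 1 := by
    ext i j
    have h := congrFun (congrFun hi i) j
    have h' := congrArg (fun x : FiniteAdeleRing (𝓞 k) k => x v) h
    simp only [finM, adMat, Matrix.map_apply, Matrix.one_apply] at h'
    have hl : finPart k (algebraMap k (Ad k) ((A : Matrix (Fin 4) (Fin 4) k) i j)) v =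
        algebraMap k (v.adicCompletion k) ((A : Matrix (Fin 4) (Fin 4) k) i j) := by
      show (algebraMap k (FiniteAdeleRing (𝓞 k) k) _) v = _
      rfl
    rw [hl] at h'
    by_cases hij : i = j
    · subst hij
      simp only [if_true] at h'
      rw [Matrix.one_apply_eq]
      apply hinj
      rw [map_one]
      exact h'
    · simp only [hij, if_false] at h'
      rw [Matrix.one_apply_ne hij]
      apply hinj
      rw [map_zero]
      exact h'
  apply Subtype.ext
  apply Units.ext
  show GA.mat W g = 1
  rw [hmat, hA1]
  exact Matrix.map_one _ (map_zero _) (map_one _)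

/-- **`T(k) ∩ T_∞ = 1`** inside `T(𝔸)`. -/
theorem rationalOf_inf_torusInf_eq_bot : rationalOf W (torusT W) ⊓ torusInf W = ⊥ := by
  rw [Subgroup.eq_bot_iff_forall]
  intro t ht
  obtain ⟨hr, hi⟩ := Subgroup.mem_inf.1 ht
  rw [rationalOf, Subgroup.mem_subgroupOf] at hr
  rw [torusInf, Subgroup.mem_subgroupOf] at hi
  exact Subtype.ext (eq_one_of_mem_rationalPoints_of_mem_infinitePart W hr hi)

/-- `T(k)` is closed in `T(𝔸)` (the preimage of the closed `U(W)(k)`). -/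
theorem isClosed_rationalOf_torusT : IsClosed ((rationalOf W (torusT W) : Subgroup (torusT W)) : Set (torusT W)) := by
  have h : ((rationalOf W (torusT W) : Subgroup (torusT W)) : Set (torusT W)) =
      Subtype.val ⁻¹' ((rationalPoints W : Subgroup (GA W)) : Set (GA W)) := by
    ext t
    simp only [Set.mem_preimage, SetLike.mem_coe, rationalOf, Subgroup.mem_subgroupOf]
  rw [h]
  exact (rationalPoints_closed W).preimage continuous_subtype_val

/-- **`T(k) · T_∞` is closed in `T(𝔸)`** when `T_∞` is compact (the line's planes: TorusInfCompact under `hcm`): a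
closed subgroup times a compact subgroup. -/
theorem isClosed_rationalOf_mul_torusInf [CompactSpace (torusInf W)] :
    IsClosed (((rationalOf W (torusT W) : Subgroup (torusT W)) : Set (torusT W)) *
      ((torusInf W : Subgroup (torusT W)) : Set (torusT W))) :=
  (isClosed_rationalOf_torusT W).mul_right_of_isCompact (isCompact_iff_compactSpace.mpr ‹_›)

end Summit.Ventures.HodgeRepro.Tier4.Line4

end
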